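import Literature.Probability.Percolation.MarkedLoopRhombusCensusOne
import Literature.Probability.Percolation.MarkedLoopRhombusCensusTwo
import Literature.Probability.Percolation.MarkedLoopRhombusCensusThree
import Literature.Probability.Percolation.MarkedLoopSevenClasses
import HarnessLib

/-!
# Seven disorders: the tripod law is NECESSARY for discrete holomorphicity — the class defects («TRIPOD-NECESSITY-SEVEN», census half)

Topic `Literature/Probability/Percolation`; generic-`k` layer of the three-disorder lineage (Khristoforov–Smirnov 2021) at `k = 7`, the sequel of
`MarkedLoopNecessityFive.lean` (k = 5: one witness core, no census). At seven disorders no face of any marked domain has fewer than three picture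
classes after corner pinning, so a CENSUS of cores is unavoidable (lane record `FINDING-NEC7-SMALL-CERTIFICATE.md`); the kernel censuses of the three
two-corner faces `vB1, vB2, vB3` of ONE seven-marked domain, the 2 × 4 rhombus `rhombus24SevenB` (`MarkedLoopRhombusCensusOne/Two/Three.lean`,
64 cores each), give three FACE RELATIONS among the twenty-one class defects `A_a, N_a, M_a` (`MarkedLoopSevenClasses.lean`):

  `(P)  16τ²·A_{a−1} + 16·A_a + 32·M_a = 0`, `(R)  12τ·A_{a−1} + 20τ²·A_a + 20τ²·M_a + 12τ²·N_a = 0`,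
  `(R′) 11τ²·A_{a−1} + 23·A_a + 5·M_a + 25·N_a = 0`

at `a = 5, 2, 6` respectively (`relation_vB2/vB1/vB3`), hence at EVERY `a` by applying them to the seven rotations of the marks (`§ Transport` of
SEVEN-CLASSES). The elimination `(55/4)·P − 25τ·R + 12·R′` (using `τ³ = 1`) is the two-term recurrence `A_a = 13τ²·A_{a−1}` around `ℤ/7`,
whose only solution is zero since `1 − 13⁷τ² ≠ 0` (`cyclic_elim_seven`); then `M ≡ 0` by `(P)` and `N ≡ 0` by `(R′)`. Result:
★★★ `classDefects_eq_zero_of_forall_holomorphicW_seven` — a seven-disorder class weight discretely holomorphic on every seven-marked domain has all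
twenty-one class defects zero — and ★★★ `classDefects_eq_zero_of_holomorphicW_rotates_seven`: the SEVEN ROTATIONS OF THE ONE MARKED RHOMBUS suffice.
With the classification of the pictures of seven corners (`MarkedLoopPicturesSeven.lean`: every tripod picture is a reading of one of the 21
classes) this is «TRIPOD LAW ⟺ HOLOMORPHIC ON EVERY SEVEN-MARKED DOMAIN» (`MarkedLoopNecessitySevenIff.lean`). The converse at `k = 7` is the
lane's statement; Khristoforov–Smirnov prove sufficiency (Lemma 4).

## References
* M. Khristoforov, S. Smirnov, *Percolation and O(1) loop model*, arXiv:2111.15612 (2021), §1.2 (arXiv v1 p. 2: cyclic indexing of the marked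
  points, link patterns), §2 Definition 3 and Lemma 4 with its proof and Fig. 3, eq. (3) (p. 4).
* B. Bollobás, O. Riordan, *Percolation*, Cambridge University Press (2006), Ch. 7 §7.2.2 (pp. 192–193: marked discrete domains), §7.2.3 p. 197
  (re-marking by relabelling).

## Mathlib / tree
Tree: `MarkedLoopRhombusCensusOne/Two/Three.lean` (`face_relation_vB1/vB2/vB3`, `picB*_*`), `MarkedLoopSevenClasses.lean` (`defA`, `defN`, `defM`, `reading`,
`defectAt_reading_*`, `classDefects_iterate`, `forall_holomorphicW_iterate₇`, `holomorphicW_rotate_iterate_iff₇`, `tau_sq_eq₇`, `tau_im_ne_zero₇`),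
`TriRhombusDomain.lean` (`rhombus24SevenB`). Mathlib: `linear_combination`, `Fin.cast_val_eq_self` (scoped `Fin.NatCast`), `decide`.
-/

open Finset

namespace Literature.Probability.Percolation.MarkedLoops

open Literature.Probability.Percolation Literature.Probability.LatticeModels
open Literature.Probability.Percolation.FivePoint (tau)
open TriMarkedDomain

/-! ### The three face relations in class-defect form -/
section Relations

/-- the realised pictures of the census are readings of the classes (finite check). [cite: KhristoforovSmirnov2021, §2 Lemma 4, Fig. 3 (arXiv v1 p. 4)] -/
theorem pics_eq_reading :
    picB2_1 = reading 5 6 ∧ picB2_2 = reading 5 0 ∧ picB2_3 = reading 4 1 ∧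
    picB1_1 = reading 2 1 ∧ picB1_2 = reading 2 7 ∧ picB1_3 = reading 1 2 ∧ picB1_4 = reading 2 4 ∧
    picB3_1 = reading 6 3 ∧ picB3_2 = reading 6 0 ∧ picB3_3 = reading 5 1 ∧ picB3_4 = reading 6 6 := by
  unfold picB2_1 picB2_2 picB2_3 picB1_1 picB1_2 picB1_3 picB1_4 picB3_1 picB3_2 picB3_3 picB3_4 reading adjRel nestRel midRel
  decide

/-- ★ **(P) at the face `vB2`** (corner sides to `y_5, y_6`): `16τ²·A_4 + 16·A_5 + 32·M_5 = 0` for every weight holomorphic on the rhombus.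
[cite: KhristoforovSmirnov2021, §2 Lemma 4 eq. (3) (arXiv v1 p. 4)] -/
theorem relation_vB2 {w : Fin 7 → Finset (Fin 7 × Fin 7) → ℂ} (hw : HolomorphicW rhombus24SevenB w) :
    16 * tau ^ 2 * defA w 4 + 16 * defA w 5 + 32 * defM w 5 = 0 := by
  have h := face_relation_vB2 hw
  obtain ⟨e1, e2, e3, -⟩ := pics_eq_reading
  rw [e1, e2, e3, defectAt_reading_six, defectAt_reading_zero, defectAt_reading_one] at h
  linear_combination h

/-- ★ **(R) at the face `vB1`** (corner sides to `y_2, y_3`): `12τ·A_1 + 20τ²·A_2 + 20τ²·M_2 + 12τ²·N_2 = 0`.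
[cite: KhristoforovSmirnov2021, §2 Lemma 4 eq. (3) (arXiv v1 p. 4)] -/
theorem relation_vB1 {w : Fin 7 → Finset (Fin 7 × Fin 7) → ℂ} (hw : HolomorphicW rhombus24SevenB w) :
    12 * tau * defA w 1 + 20 * tau ^ 2 * defA w 2 + 20 * tau ^ 2 * defM w 2 + 12 * tau ^ 2 * defN w 2 = 0 := by
  have h := face_relation_vB1 hw
  obtain ⟨-, -, -, e1, e2, e3, e4, -⟩ := pics_eq_reading
  rw [e1, e2, e3, e4, defectAt_reading_one, defectAt_reading_seven, defectAt_reading_two, defectAt_reading_four] at h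
  linear_combination h

/-- ★ **(R′) at the face `vB3`** (corner sides to `y_6, y_0`): `11τ²·A_5 + 23·A_6 + 5·M_6 + 25·N_6 = 0`.
[cite: KhristoforovSmirnov2021, §2 Lemma 4 eq. (3) (arXiv v1 p. 4)] -/
theorem relation_vB3 {w : Fin 7 → Finset (Fin 7 × Fin 7) → ℂ} (hw : HolomorphicW rhombus24SevenB w) :
    11 * tau ^ 2 * defA w 5 + 23 * defA w 6 + 5 * defM w 6 + 25 * defN w 6 = 0 := by
  have h := face_relation_vB3 hw
  obtain ⟨-, -, -, -, -, -, -, e1, e2, e3, e4⟩ := pics_eq_reading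
  rw [e1, e2, e3, e4, defectAt_reading_three, defectAt_reading_zero, defectAt_reading_one, defectAt_reading_six] at h
  linear_combination h

end Relations

/-! ### The elimination around `ℤ/7` -/
section Elimination

/-- ★ a two-term recurrence `X·δ(c+1) + Y·δ(c) = 0` around `ℤ/7` with `X⁷ + Y⁷ ≠ 0` has only the zero solution.
[cite: KhristoforovSmirnov2021, §1.2 (arXiv v1 p. 2: the marked points are indexed cyclically)] -/
theorem cyclic_elim_seven {X Y : ℂ} {δ : Fin 7 → ℂ} (h : ∀ c : Fin 7, X * δ (c + 1) + Y * δ c = 0) (hXY : X ^ 7 + Y ^ 7 ≠ 0) :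
    ∀ c : Fin 7, δ c = 0 := by
  intro c
  have h0 := h c
  have h1 := h (c + 1)
  have h2 := h (c + 1 + 1)
  have h3 := h (c + 1 + 1 + 1)
  have h4 := h (c + 1 + 1 + 1 + 1)
  have h5 := h (c + 1 + 1 + 1 + 1 + 1)
  have h6 := h (c + 1 + 1 + 1 + 1 + 1 + 1)
  have e7all : ∀ c : Fin 7, c + 1 + 1 + 1 + 1 + 1 + 1 + 1 = c := by decide
  rw [e7all c] at h6
  have key : (X ^ 7 + Y ^ 7) * δ c = 0 := by
    linear_combination Y ^ 6 * h0 - X * Y ^ 5 * h1 + X ^ 2 * Y ^ 4 * h2 - X ^ 3 * Y ^ 3 * h3 + X ^ 4 * Y ^ 2 * h4 - X ^ 5 * Y * h5 +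
      X ^ 6 * h6
  exact (mul_eq_zero.1 key).resolve_left hXY

/-- the non-degeneracy of the lane's certificate: `1 + (−13τ²)⁷ = 1 − 13⁷·τ² ≠ 0` (`τ²` is not real).
[cite: KhristoforovSmirnov2021, §2 Definition 3 (arXiv v1 p. 4: `τ = e^{2πi/3}`)] -/
theorem one_add_pow_seven_ne_zero : (1 : ℂ) ^ 7 + (-13 * tau ^ 2) ^ 7 ≠ 0 := by
  have hsq : tau ^ 2 = -1 - tau := tau_sq_eq₇
  have h3 : tau ^ 3 = 1 := by linear_combination (tau - 1) * hsq
  have e : (1 : ℂ) ^ 7 + (-13 * tau ^ 2) ^ 7 = 1 + 13 ^ 7 + 13 ^ 7 * tau := by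
    linear_combination (-(13 : ℂ) ^ 7 * (tau ^ 11 + tau ^ 8 + tau ^ 5 + tau ^ 2)) * h3 - (13 : ℂ) ^ 7 * hsq
  rw [e]
  intro h0
  have him := congrArg Complex.im h0
  simp only [Complex.add_im, Complex.one_im, Complex.mul_im, Complex.zero_im] at him
  norm_num at him
  exact tau_im_ne_zero₇ him

/-- index bookkeeping in `ℤ/7` for the transport of the three relations. [folklore] -/
private theorem fin7_idx : ∀ a : Fin 7,
    ((5 : Fin 7) - (5 - a) = a ∧ (4 : Fin 7) - (5 - a) = a - 1) ∧ ((2 : Fin 7) - (2 - a) = a ∧ (1 : Fin 7) - (2 - a) = a - 1) ∧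
      ((6 : Fin 7) - (6 - a) = a ∧ (5 : Fin 7) - (6 - a) = a - 1) := by
  decide

open Fin.NatCast in
/-- ★★ **the three relations at every class index**, for a weight holomorphic on the seven rotations of the rhombus (apply each face relation
to the back-rotated weights). [cite: KhristoforovSmirnov2021, §2 Lemma 4 eq. (3) (arXiv v1 p. 4); BollobasRiordan2006, Ch. 7 §7.2.3 p. 197] -/
theorem relations_all (wt : Fin 7 → Finset (Fin 7 × Fin 7) → ℂ) (h : ∀ m : ℕ, m < 7 → HolomorphicW (TriMarkedDomain.rotate^[m] rhombus24SevenB) wt)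
    (a : Fin 7) :
    16 * tau ^ 2 * defA wt (a - 1) + 16 * defA wt a + 32 * defM wt a = 0 ∧
      12 * tau * defA wt (a - 1) + 20 * tau ^ 2 * defA wt a + 20 * tau ^ 2 * defM wt a + 12 * tau ^ 2 * defN wt a = 0 ∧
        11 * tau ^ 2 * defA wt (a - 1) + 23 * defA wt a + 5 * defM wt a + 25 * defN wt a = 0 := by
  obtain ⟨⟨p1, p2⟩, ⟨r1, r2⟩, ⟨s1, s2⟩⟩ := fin7_idx a
  have hol : ∀ c : Fin 7, HolomorphicW rhombus24SevenB ((rotW (rot 7).symm)^[((c : Fin 7) : ℕ)] wt) := fun c =>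
    (holomorphicW_rotate_iterate_iff₇ _ rhombus24SevenB wt).1 (h _ c.isLt)
  refine ⟨?_, ?_, ?_⟩
  · have hw := relation_vB2 (hol (5 - a))
    rw [(classDefects_iterate wt _ 4).1, (classDefects_iterate wt _ 5).1, (classDefects_iterate wt _ 5).2.2, Fin.cast_val_eq_self, p1, p2] at hw
    exact hw
  · have hw := relation_vB1 (hol (2 - a))
    rw [(classDefects_iterate wt _ 1).1, (classDefects_iterate wt _ 2).1, (classDefects_iterate wt _ 2).2.2, (classDefects_iterate wt _ 2).2.1,
      Fin.cast_val_eq_self, r1, r2] at hw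
    exact hw
  · have hw := relation_vB3 (hol (6 - a))
    rw [(classDefects_iterate wt _ 5).1, (classDefects_iterate wt _ 6).1, (classDefects_iterate wt _ 6).2.2, (classDefects_iterate wt _ 6).2.1,
      Fin.cast_val_eq_self, s1, s2] at hw
    exact hw

/-- ★★★ **NECESSITY FOR SEVEN DISORDERS, FROM ONE MARKED DOMAIN**: a seven-disorder class weight that is discretely holomorphic on the seven rotations
(relabellings of the marks) of the seven-marked rhombus `rhombus24SevenB` has ALL TWENTY-ONE CLASS DEFECTS ZERO. The elimination:
`(55/4)·(P) − 25τ·(R) + 12·(R′)` is `A_a = 13τ²·A_{a−1}` (using `τ³ = 1`), a two-term recurrence around `ℤ/7` with `1 − 13⁷τ² ≠ 0`, so `A ≡ 0`;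
then `M ≡ 0` by `(P)` and `N ≡ 0` by `(R′)`. [cite: KhristoforovSmirnov2021, §2 Lemma 4 (arXiv v1 p. 4: sufficiency); BollobasRiordan2006, Ch. 7 §7.2.2
(pp. 192–193), §7.2.3 p. 197] -/
theorem classDefects_eq_zero_of_holomorphicW_rotates_seven (wt : Fin 7 → Finset (Fin 7 × Fin 7) → ℂ)
    (h : ∀ m : ℕ, m < 7 → HolomorphicW (TriMarkedDomain.rotate^[m] rhombus24SevenB) wt) (a : Fin 7) :
    defA wt a = 0 ∧ defN wt a = 0 ∧ defM wt a = 0 := by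
  have h3 : tau ^ 3 = 1 := by linear_combination (tau - 1) * tau_sq_eq₇
  have hrec : ∀ c : Fin 7, (1 : ℂ) * defA wt (c + 1) + (-13 * tau ^ 2) * defA wt c = 0 := by
    intro c
    obtain ⟨hP, hR, hR'⟩ := relations_all wt h (c + 1)
    rw [add_sub_cancel_right] at hP hR hR'
    linear_combination (-(55 : ℂ) / 16) * hP + ((25 : ℂ) / 4) * tau * hR - 3 * hR' +
      (-(125 : ℂ) * defA wt (c + 1) - 125 * defM wt (c + 1) - 75 * defN wt (c + 1)) * h3
  have hA : ∀ c : Fin 7, defA wt c = 0 := cyclic_elim_seven hrec one_add_pow_seven_ne_zero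
  obtain ⟨hP, -, hR'⟩ := relations_all wt h a
  rw [hA a, hA (a - 1)] at hP hR'
  have hM : defM wt a = 0 := by linear_combination hP / 32
  rw [hM] at hR'
  have hN : defN wt a = 0 := by linear_combination hR' / 25
  exact ⟨hA a, hN, hM⟩

/-- ★★★ **NECESSITY FOR SEVEN DISORDERS**: a seven-disorder class weight discretely holomorphic on EVERY seven-marked domain has all twenty-one class
defects zero. [cite: KhristoforovSmirnov2021, §2 Lemma 4 (arXiv v1 p. 4: sufficiency); BollobasRiordan2006, Ch. 7 §7.2.2 (pp. 192–193), §7.2.3 p. 197] -/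
theorem classDefects_eq_zero_of_forall_holomorphicW_seven (wt : Fin 7 → Finset (Fin 7 × Fin 7) → ℂ)
    (h : ∀ D : TriMarkedDomain 7, HolomorphicW D wt) (a : Fin 7) : defA wt a = 0 ∧ defN wt a = 0 ∧ defM wt a = 0 :=
  classDefects_eq_zero_of_holomorphicW_rotates_seven wt (fun _ _ => h _) a

end Elimination

end Literature.Probability.Percolation.MarkedLoops
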